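import Summits.QuantumFields.BalabanUV.Beta.EriceRemainderEnclosureHistoryAutonomyComparisonFourAgesSteps
import Summits.QuantumFields.BalabanUV.Beta.EriceRemainderEnclosureHistoryAutonomyComparisonTowerFreeEndsBudget

/-!
# EriceRemainderEnclosureHistoryAutonomyComparisonChainFourAges — (E68c) THE WINDOW BUDGET CLOSES THE DUAL CHAIN ON EVERY AGE SET OF DEPTH ≤ 3 (AT MOST
# FOUR AGES), WHATEVER THE RATIOS: chain values `λ_{m₀} = σ₀` (exact), `λ = H₁(Z) = (11∕10)Z∕(1 − (9∕10)Z)` at the second age, `λ = H₂(Z) =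
# (13∕10)Z∕(1 − (23∕20)Z)` at the third, the minimal recursion value at the oldest; the three steps are (E68b) `first_step_tight`, `middle_step_free`,
# `last_step_from_H2`, each for ANY ratio under (E67b)'s crude line.  With (E68d): **every set of at most four ages compares** at any size

Cell `pub-balaban`, β-function sub-cell, BINDER row D4 «RemainderConst leaves for Bałaban's split» (`HOME/BINDER-OWNERS.md`; owner lineage `b2b-balaban-beta-an4`;
this file by co-owner #2 lineage `b2b-balaban-beta-d4-p2`, generation 59), β-FLOW TEAM duty (1), FREEZE (0) honoured (def-free; (E66a)
`load_le_of_window_budget`, (E67b) `crude_line_at`, (E67c) `sum_le_of_crude_line`, (E68b) steps BY NAME).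

HONEST FRAMING (page 1, verbatim and binding).  *"Discharging BetaPertH makes Bałaban's UV stability UNCONDITIONAL — a real constructive-QFT result; it is
NOT the continuum limit and NOT the Clay problem."*  THIS FILE DISCHARGES NOTHING OF THE KIND.  A lemma about finitely many non-negative reals; its use is
through (E65f), whose hypotheses are those of a census, not facts; nothing of Bałaban's is asserted.  Row D4 class UNCHANGED (critical-path width 0; instance
0∕1; D4 DISCHARGE NO DATE).  HONEST DEPENDENCY: continuum YM on T⁴ ⇐ BetaPertH ∧ nine spine estimates (0/9 proved); BetaPertH ⇐ (D1) ∧ (D4) ∧ CAP+tail;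
G-an2-4 gates asym, D1 and NE2/3/4.

THE POINT (census sense (α); the COMPARISON column, conjecture (E58′)).  Two consecutive free steps leave (E66b)'s region `λ ≤ 4Z∕(2 − Z)` (numerics: the image
of that region under one free step reaches `λ = 12` and the next condition `2.2`); but the REACHABLE envelope after the first step is the much tighter `H₁`
(`≈` the lone-age curve), whose image `H₂` still satisfies the last condition (`≤ 0.85`).  A fifth age breaks this relaxation (`1.13`, README).  NOT CLAIMED:
five ages; anything printed.

WHAT IS PROVED ([folklore]; 0 `def`, 0 sorry).  **`dual_chain_of_depth_le_three`**.
-/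
noncomputable section
open Finset

namespace Summit.QuantumFields.BalabanUV.Beta.EriceRemainderEnclosureHistoryAutonomyComparisonChainFourAges

open Summit.QuantumFields.BalabanUV.Beta.EriceRemainderEnclosureHistoryAutonomyComparisonTowerChainFourLemmas (load_le_of_window_budget)
open Summit.QuantumFields.BalabanUV.Beta.EriceRemainderEnclosureHistoryAutonomyComparisonFourAgesSteps (first_step_tight middle_step_free last_step_from_H2)
open Summit.QuantumFields.BalabanUV.Beta.EriceRemainderEnclosureHistoryAutonomyComparisonTowerFreeEndsBudget (crude_line_at)
open Summit.QuantumFields.BalabanUV.Beta.EriceRemainderEnclosureHistoryAutonomyComparisonTowerRatioFourStep (sum_le_of_crude_line)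

set_option maxHeartbeats 1600000 in
/-- **THE WINDOW BUDGET CLOSES THE DUAL CHAIN ON EVERY AGE SET OF DEPTH ≤ 3.**  `A` a finite set of ages `≥ 1` with minimum `m₀`, maximum `M₀` and predecessor map
`pred`, such that every age three predecessor-steps above `m₀` is the maximum (so `#A ≤ 4`); loads `x ≥ 0` obeying the WINDOW BUDGET of (E65a) at every scale
`j = k ∈ A`.  Then there are `μ, λ ≥ 0` on `A` satisfying every inequality of the dual chain of (E65e) (as demanded by (E65f)) — no hypothesis on the ratios.
[folklore] -/
theorem dual_chain_of_depth_le_three {A : Finset ℕ} {x : ℕ → ℝ} {pred : ℕ → ℕ} {m₀ M₀ : ℕ}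
    (hA1 : ∀ k ∈ A, 1 ≤ k) (hx : ∀ k ∈ A, 0 ≤ x k) (hm₀ : m₀ ∈ A) (hmin : ∀ k ∈ A, m₀ ≤ k) (hmax : ∀ k ∈ A, k ≤ M₀)
    (hpred : ∀ k ∈ A, k ≠ m₀ → pred k ∈ A ∧ pred k < k ∧ ∀ k'' ∈ A, k'' < k → k'' ≤ pred k)
    (hdepth : ∀ k ∈ A, k ≠ m₀ → pred k ≠ m₀ → pred (pred k) ≠ m₀ → k = M₀)
    (hbud : ∀ k ∈ A, ∑ s ∈ A, x s * (if s ≤ k then (∑ l ∈ range k, Real.sqrt ((s : ℝ) / ((s : ℝ) + l + 1))) / k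
        else (∑ l ∈ range k, Real.sqrt ((s : ℝ) / ((s : ℝ) + l + 1))) / s) ≤ 1 / 2) :
    ∃ μ lam : ℕ → ℝ, (∀ k ∈ A, 0 ≤ μ k) ∧ (∀ k ∈ A, 0 ≤ lam k) ∧
      3 / 4 * x m₀ ≤ μ m₀ * (1 - 3 / 4 * x m₀) ∧ x m₀ ≤ lam m₀ * (1 - 3 / 4 * x m₀) ∧
      (∀ k ∈ A, k ≠ m₀ →
        x k * (min (4 * (pred k : ℝ) * k / ((k : ℝ) + pred k) ^ 2 * μ (pred k)) (2 * lam (pred k) * ((pred k : ℝ) / k)) + 3 / 4) < 1) ∧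
      (∀ k ∈ A, k ≠ m₀ →
        min (4 * (pred k : ℝ) * k / ((k : ℝ) + pred k) ^ 2 * μ (pred k)) (2 * lam (pred k) * ((pred k : ℝ) / k)) * (1 + x k) + 3 / 4 * x k ≤
          μ k * (1 - x k * (3 / 4 + min (4 * (pred k : ℝ) * k / ((k : ℝ) + pred k) ^ 2 * μ (pred k)) (2 * lam (pred k) * ((pred k : ℝ) / k))))) ∧
      (∀ k ∈ A, k ≠ m₀ →
        lam (pred k) * ((pred k : ℝ) / k) * (1 + x k / 4) +
            x k * (1 + min (4 * (pred k : ℝ) * k / ((k : ℝ) + pred k) ^ 2 * μ (pred k)) (2 * lam (pred k) * ((pred k : ℝ) / k))) ≤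
          lam k * (1 - x k * (3 / 4 + min (4 * (pred k : ℝ) * k / ((k : ℝ) + pred k) ^ 2 * μ (pred k)) (2 * lam (pred k) * ((pred k : ℝ) / k))))) := by
  classical
  have hcap : ∀ k ∈ A, x k ≤ 71 / 100 := fun k hk => (load_le_of_window_budget hA1 hx hk (hbud k hk)).2
  have hx₀ := hx m₀ hm₀
  have hc₀ := hcap m₀ hm₀
  have hden₀ : 0 < 1 - 3 / 4 * x m₀ := by linarith
  obtain ⟨Z, hZ_def⟩ : ∃ Z : ℕ → ℝ, Z = fun k => ∑ s ∈ A.filter (fun s => s ≤ k), x s * Real.sqrt ((s : ℝ) / k) := ⟨_, rfl⟩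
  have hZ0 : ∀ k, 0 ≤ Z k := fun k => by
    rw [hZ_def]; exact sum_nonneg fun s hs => mul_nonneg (hx s (mem_filter.mp hs).1) (Real.sqrt_nonneg _)
  obtain ⟨H1, hH1_def⟩ : ∃ H1 : ℕ → ℝ, H1 = fun k => 11 / 10 * Z k / (1 - 9 / 10 * Z k) := ⟨_, rfl⟩
  obtain ⟨H2, hH2_def⟩ : ∃ H2 : ℕ → ℝ, H2 = fun k => 13 / 10 * Z k / (1 - 23 / 20 * Z k) := ⟨_, rfl⟩
  have hH1k : ∀ k, H1 k = 11 / 10 * Z k / (1 - 9 / 10 * Z k) := fun k => by rw [hH1_def]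
  have hH2k : ∀ k, H2 k = 13 / 10 * Z k / (1 - 23 / 20 * Z k) := fun k => by rw [hH2_def]
  obtain ⟨σ₀, hσ₀_def⟩ : ∃ σ₀ : ℝ, σ₀ = x m₀ / (1 - 3 / 4 * x m₀) := ⟨_, rfl⟩
  obtain ⟨μ₀, hμ₀_def⟩ : ∃ μ₀ : ℝ, μ₀ = (3 / 4 * x m₀) / (1 - 3 / 4 * x m₀) := ⟨_, rfl⟩
  have hσ₀0 : 0 ≤ σ₀ := by rw [hσ₀_def]; exact div_nonneg hx₀ hden₀.le
  have hμ₀0 : 0 ≤ μ₀ := by rw [hμ₀_def]; exact div_nonneg (by linarith) hden₀.le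
  have hμσ : μ₀ = 3 / 4 * σ₀ := by rw [hμ₀_def, hσ₀_def]; ring
  obtain ⟨lamp, hlamp_def⟩ : ∃ lamp : ℕ → ℝ, lamp = fun k => if pred k = m₀ then σ₀ else if pred (pred k) = m₀ then H1 (pred k) else H2 (pred k) :=
    ⟨_, rfl⟩
  obtain ⟨eb, heb_def⟩ : ∃ eb : ℕ → ℝ, eb = fun k => if pred k = m₀ then
      min (4 * (pred k : ℝ) * k / ((k : ℝ) + pred k) ^ 2 * μ₀) (2 * σ₀ * ((pred k : ℝ) / k)) else 2 * lamp k * ((pred k : ℝ) / k) := ⟨_, rfl⟩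
  obtain ⟨lam, hlam_def⟩ : ∃ lam : ℕ → ℝ, lam = fun k => if k = m₀ then σ₀ else if k = M₀ then
      (lamp k * ((pred k : ℝ) / k) * (1 + x k / 4) + x k * (1 + eb k)) / (1 - x k * (3 / 4 + eb k))
      else if pred k = m₀ then H1 k else H2 k := ⟨_, rfl⟩
  obtain ⟨μ, hμ_def⟩ : ∃ μ : ℕ → ℝ, μ = fun k => if k = m₀ then μ₀
      else (eb k * (1 + x k) + 3 / 4 * x k) / (1 - x k * (3 / 4 + eb k)) := ⟨_, rfl⟩
  -- Z at the youngest age and the splitting at the others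
  have hZm : Z m₀ = x m₀ := by
    have hset : A.filter (fun s => s ≤ m₀) = {m₀} := by
      ext s; simp only [mem_filter, mem_singleton]
      constructor
      · rintro ⟨hs, hsm⟩; exact le_antisymm hsm (hmin s hs)
      · rintro rfl; exact ⟨hm₀, le_rfl⟩
    have hm1 : (0 : ℝ) < m₀ := by exact_mod_cast hA1 m₀ hm₀
    rw [hZ_def]; simp only [hset, sum_singleton]
    rw [div_self hm1.ne', Real.sqrt_one, mul_one]
  have hsplit : ∀ k ∈ A, k ≠ m₀ → Z k = x k + Real.sqrt ((pred k : ℝ) / k) * Z (pred k) := by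
    intro k hk hne
    obtain ⟨hpA, hplt, hpmax⟩ := hpred k hk hne
    have hkr : (0 : ℝ) < k := by exact_mod_cast hA1 k hk
    have hpr : (0 : ℝ) < pred k := by exact_mod_cast hA1 _ hpA
    have hset2 : A.filter (fun s => s ≤ k) = insert k (A.filter (fun s => s ≤ pred k)) := by
      ext s; simp only [mem_filter, mem_insert]
      constructor
      · rintro ⟨hs, hsk⟩
        rcases lt_or_eq_of_le hsk with h | h
        · exact Or.inr ⟨hs, hpmax s hs h⟩
        · exact Or.inl h
      · rintro (rfl | ⟨hs, hsp⟩)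
        · exact ⟨hk, le_rfl⟩
        · exact ⟨hs, hsp.trans hplt.le⟩
    have hnot : k ∉ A.filter (fun s => s ≤ pred k) := by
      simp only [mem_filter, not_and, not_le]; exact fun _ => hplt
    rw [hZ_def]; simp only [hset2, sum_insert hnot]
    rw [div_self hkr.ne', Real.sqrt_one, mul_one, mul_sum]
    congr 1
    refine sum_congr rfl fun s hs => ?_
    have hs0 : (0 : ℝ) ≤ s := Nat.cast_nonneg s
    rw [show (s : ℝ) / k = (pred k : ℝ) / k * ((s : ℝ) / pred k) by field_simp, Real.sqrt_mul (by positivity)]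
    ring
  -- the crude line at every non-minimal age, the ratio bounds, and Z ≤ 71/100 everywhere
  have hlinec : ∀ k ∈ A, k ≠ m₀ → x k * Real.sqrt (1 / 2) +
      Z (pred k) * Real.sqrt (((pred k : ℝ) / k) / (1 + (pred k : ℝ) / k)) ≤ 1 / 2 := by
    intro k hk hne
    have := crude_line_at hA1 hx hpred hbud hk hne
    rw [hZ_def]; exact this
  have hratio : ∀ k ∈ A, k ≠ m₀ → 0 < (pred k : ℝ) / k ∧ (pred k : ℝ) / k ≤ 1 := by
    intro k hk hne
    obtain ⟨hpA, hplt, _⟩ := hpred k hk hne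
    have hkr : (0 : ℝ) < k := by exact_mod_cast hA1 k hk
    have hpr : (0 : ℝ) < pred k := by exact_mod_cast hA1 _ hpA
    exact ⟨by positivity, by rw [div_le_one hkr]; exact_mod_cast hplt.le⟩
  have hZle : ∀ k ∈ A, Z k ≤ 71 / 100 := by
    intro k hk
    by_cases hkm : k = m₀
    · rw [hkm, hZm]; exact hc₀
    · obtain ⟨hr0, hr1⟩ := hratio k hk hkm
      rw [hsplit k hk hkm]
      exact sum_le_of_crude_line (hx k hk) (hZ0 _) hr0.le hr1 (hlinec k hk hkm)
  have hH10 : ∀ k ∈ A, 0 ≤ H1 k := fun k hk => by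
    have := hZle k hk; have := hZ0 k; rw [hH1k]; exact div_nonneg (by linarith) (by linarith)
  have hH20 : ∀ k ∈ A, 0 ≤ H2 k := fun k hk => by
    have := hZle k hk; have := hZ0 k; rw [hH2k]; exact div_nonneg (by linarith) (by linarith)
  have hpredM : ∀ k ∈ A, k ≠ m₀ → pred k ≠ M₀ := fun k hk hne h => by
    obtain ⟨_, hplt, _⟩ := hpred k hk hne
    exact absurd (hmax k hk) (by rw [← h]; exact not_le.mpr hplt)
  -- unfolding lemmas
  have hlam_m₀ : lam m₀ = σ₀ := by rw [hlam_def]; dsimp only; rw [if_pos rfl]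
  have hlam_M : ∀ k, k ≠ m₀ → k = M₀ →
      lam k = (lamp k * ((pred k : ℝ) / k) * (1 + x k / 4) + x k * (1 + eb k)) / (1 - x k * (3 / 4 + eb k)) := fun k h1 h2 => by
    rw [hlam_def]; dsimp only; rw [if_neg h1, if_pos h2]
  have hlam_1 : ∀ k, k ≠ m₀ → k ≠ M₀ → pred k = m₀ → lam k = H1 k := fun k h1 h2 h3 => by
    rw [hlam_def]; dsimp only; rw [if_neg h1, if_neg h2, if_pos h3]
  have hlam_2 : ∀ k, k ≠ m₀ → k ≠ M₀ → pred k ≠ m₀ → lam k = H2 k := fun k h1 h2 h3 => by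
    rw [hlam_def]; dsimp only; rw [if_neg h1, if_neg h2, if_neg h3]
  have hlamp_1 : ∀ k, pred k = m₀ → lamp k = σ₀ := fun k h => by rw [hlamp_def]; dsimp only; rw [if_pos h]
  have hlamp_2 : ∀ k, pred k ≠ m₀ → pred (pred k) = m₀ → lamp k = H1 (pred k) := fun k h h' => by
    rw [hlamp_def]; dsimp only; rw [if_neg h, if_pos h']
  have hlamp_3 : ∀ k, pred k ≠ m₀ → pred (pred k) ≠ m₀ → lamp k = H2 (pred k) := fun k h h' => by
    rw [hlamp_def]; dsimp only; rw [if_neg h, if_neg h']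
  have hlam_pred : ∀ k ∈ A, k ≠ m₀ → lam (pred k) = lamp k := by
    intro k hk hne
    have hpA := (hpred k hk hne).1
    by_cases h1 : pred k = m₀
    · rw [hlamp_1 k h1, h1, hlam_m₀]
    by_cases h2 : pred (pred k) = m₀
    · rw [hlamp_2 k h1 h2, hlam_1 (pred k) h1 (hpredM k hk hne) h2]
    · rw [hlamp_3 k h1 h2, hlam_2 (pred k) h1 (hpredM k hk hne) h2]
  have hlamp0 : ∀ k ∈ A, k ≠ m₀ → 0 ≤ lamp k := by
    intro k hk hne
    have hpA := (hpred k hk hne).1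
    by_cases h1 : pred k = m₀
    · rw [hlamp_1 k h1]; exact hσ₀0
    by_cases h2 : pred (pred k) = m₀
    · rw [hlamp_2 k h1 h2]; exact hH10 _ hpA
    · rw [hlamp_3 k h1 h2]; exact hH20 _ hpA
  have hμ_m₀ : μ m₀ = μ₀ := by rw [hμ_def]; dsimp only; rw [if_pos rfl]
  have hμk : ∀ k, k ≠ m₀ → μ k = (eb k * (1 + x k) + 3 / 4 * x k) / (1 - x k * (3 / 4 + eb k)) := fun k hk => by
    rw [hμ_def]; dsimp only; rw [if_neg hk]
  have heb_1 : ∀ k, pred k = m₀ →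
      eb k = min (4 * (pred k : ℝ) * k / ((k : ℝ) + pred k) ^ 2 * μ₀) (2 * σ₀ * ((pred k : ℝ) / k)) := fun k h => by
    rw [heb_def]; dsimp only; rw [if_pos h]
  have heb_2 : ∀ k, pred k ≠ m₀ → eb k = 2 * lamp k * ((pred k : ℝ) / k) := fun k h => by rw [heb_def]; dsimp only; rw [if_neg h]
  have heb0 : ∀ k ∈ A, k ≠ m₀ → 0 ≤ eb k := by
    intro k hk hne
    by_cases h1 : pred k = m₀
    · rw [heb_1 k h1]; exact le_min (by positivity) (by positivity)
    · rw [heb_2 k h1]; have := hlamp0 k hk hne; positivity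
  have he_le : ∀ k ∈ A, k ≠ m₀ →
      min (4 * (pred k : ℝ) * k / ((k : ℝ) + pred k) ^ 2 * μ (pred k)) (2 * lam (pred k) * ((pred k : ℝ) / k)) ≤ eb k := by
    intro k hk hne
    by_cases h1 : pred k = m₀
    · rw [heb_1 k h1, h1, hμ_m₀, hlam_m₀]
    · rw [heb_2 k h1, hlam_pred k hk hne]; exact min_le_right _ _
  -- the three steps
  have hstep1 : ∀ k ∈ A, k ≠ m₀ → pred k = m₀ →
      x k * (eb k + 3 / 4) < 1 ∧
      σ₀ * ((pred k : ℝ) / k) * (1 + x k / 4) + x k * (1 + eb k) ≤ H1 k * (1 - x k * (3 / 4 + eb k)) := by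
    intro k hk hne hpm
    obtain ⟨hr0, hr1⟩ := hratio k hk hne
    have hl := hlinec k hk hne
    have hZpm : Z (pred k) = x m₀ := by rw [hpm, hZm]
    rw [hZpm] at hl
    have ha : 4 * (pred k : ℝ) * k / ((k : ℝ) + pred k) ^ 2 = 4 * ((pred k : ℝ) / k) / (1 + (pred k : ℝ) / k) ^ 2 := by
      have hkr : (0 : ℝ) < k := by exact_mod_cast hA1 k hk
      field_simp
    have he1 : eb k ≤ 2 * ((pred k : ℝ) / k) * (x m₀ / (1 - 3 / 4 * x m₀)) := by
      rw [heb_1 k hpm, hσ₀_def]; exact (min_le_right _ _).trans (le_of_eq (by ring))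
    have he2 : eb k ≤ 3 * ((pred k : ℝ) / k) / (1 + (pred k : ℝ) / k) ^ 2 * (x m₀ / (1 - 3 / 4 * x m₀)) := by
      rw [heb_1 k hpm]; refine (min_le_left _ _).trans (le_of_eq ?_); rw [ha, hμσ, hσ₀_def]; ring
    have hfs := first_step_tight (hx k hk) hx₀ hc₀ hr0 hr1 he1 he2 hl
    have hHK : H1 k = 11 / 10 * (x k + Real.sqrt ((pred k : ℝ) / k) * x m₀) / (1 - 9 / 10 * (x k + Real.sqrt ((pred k : ℝ) / k) * x m₀)) := by
      rw [hH1k, hsplit k hk hne, hZpm]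
    refine ⟨hfs.1, ?_⟩
    rw [hHK, hσ₀_def]; exact hfs.2
  have hstep2 : ∀ k ∈ A, k ≠ m₀ → pred k ≠ m₀ → pred (pred k) = m₀ →
      x k * (eb k + 3 / 4) < 1 ∧
      lamp k * ((pred k : ℝ) / k) * (1 + x k / 4) + x k * (1 + eb k) ≤ H2 k * (1 - x k * (3 / 4 + eb k)) := by
    intro k hk hne hpm hppm
    obtain ⟨hr0, hr1⟩ := hratio k hk hne
    have hpA := (hpred k hk hne).1
    have hl := hlinec k hk hne
    have hlampk : lamp k = H1 (pred k) := hlamp_2 k hpm hppm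
    have hms := middle_step_free (lam := H1 (pred k)) (hx k hk) (hZ0 (pred k)) (hZle _ hpA) hr0 hr1 (le_of_eq (hH1k _)) hl
    have hHK : H2 k = 13 / 10 * (x k + Real.sqrt ((pred k : ℝ) / k) * Z (pred k)) / (1 - 23 / 20 * (x k + Real.sqrt ((pred k : ℝ) / k) * Z (pred k))) := by
      rw [hH2k, hsplit k hk hne]
    rw [heb_2 k hpm, hlampk, hHK]
    refine ⟨by linarith [hms.1], ?_⟩
    have e1 : 2 * H1 (pred k) * ((pred k : ℝ) / k) = 2 * ((pred k : ℝ) / k) * H1 (pred k) := by ring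
    rw [e1]; exact hms.2
  have hstep3 : ∀ k ∈ A, k ≠ m₀ → pred k ≠ m₀ → pred (pred k) ≠ m₀ → x k * (eb k + 3 / 4) < 1 := by
    intro k hk hne hpm hppm
    obtain ⟨hr0, hr1⟩ := hratio k hk hne
    have hpA := (hpred k hk hne).1
    have hl := hlinec k hk hne
    have hls := last_step_from_H2 (lam := H2 (pred k)) (hx k hk) (hZ0 (pred k)) (hZle _ hpA) hr0 hr1 (le_of_eq (hH2k _)) hl
    rw [heb_2 k hpm, hlamp_3 k hpm hppm]; linarith [hls]
  have hcond : ∀ k ∈ A, k ≠ m₀ → x k * (eb k + 3 / 4) < 1 := by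
    intro k hk hne
    by_cases h1 : pred k = m₀
    · exact (hstep1 k hk hne h1).1
    by_cases h2 : pred (pred k) = m₀
    · exact (hstep2 k hk hne h1 h2).1
    · exact hstep3 k hk hne h1 h2
  -- nonnegativity
  have hlam0 : ∀ k ∈ A, 0 ≤ lam k := by
    intro k hk
    by_cases hkm : k = m₀
    · rw [hkm, hlam_m₀]; exact hσ₀0
    by_cases hkM : k = M₀
    · rw [hlam_M k hkm hkM]
      have h1 := hcond k hk hkm; have h2 := heb0 k hk hkm; have h3 := hlamp0 k hk hkm; have h4 := hx k hk
      have h5 : 0 ≤ (pred k : ℝ) / k := by positivity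
      refine div_nonneg ?_ (by nlinarith)
      have : 0 ≤ lamp k * ((pred k : ℝ) / k) * (1 + x k / 4) := by positivity
      nlinarith
    by_cases h1 : pred k = m₀
    · rw [hlam_1 k hkm hkM h1]; exact hH10 k hk
    · rw [hlam_2 k hkm hkM h1]; exact hH20 k hk
  have hμ0 : ∀ k ∈ A, 0 ≤ μ k := by
    intro k hk
    by_cases hkm : k = m₀
    · rw [hkm, hμ_m₀]; exact hμ₀0
    · have h1 := heb0 k hk hkm; have h2 := hx k hk; have h3 := hcond k hk hkm
      rw [hμk k hkm]; exact div_nonneg (by positivity) (by nlinarith)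
  refine ⟨μ, lam, hμ0, hlam0, ?_, ?_, ?_, ?_, ?_⟩
  · rw [hμ_m₀, hμ₀_def, div_mul_cancel₀ _ hden₀.ne']
  · rw [hlam_m₀, hσ₀_def, div_mul_cancel₀ _ hden₀.ne']
  · intro k hk hkm
    have h1 := hcond k hk hkm
    nlinarith [mul_le_mul_of_nonneg_left (he_le k hk hkm) (hx k hk)]
  · intro k hk hkm
    have h1 := hcond k hk hkm
    have hxk := hx k hk
    have hmin' := he_le k hk hkm
    set e := min (4 * (pred k : ℝ) * k / ((k : ℝ) + pred k) ^ 2 * μ (pred k)) (2 * lam (pred k) * ((pred k : ℝ) / k)) with he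
    have heb0' := heb0 k hk hkm
    have hden : 0 < 1 - x k * (3 / 4 + eb k) := by nlinarith
    have hμk' : μ k * (1 - x k * (3 / 4 + eb k)) = eb k * (1 + x k) + 3 / 4 * x k := by
      rw [hμk k hkm, div_mul_cancel₀ _ hden.ne']
    have hμ0' : 0 ≤ μ k := hμ0 k hk
    have h2 : e * (1 + x k) ≤ eb k * (1 + x k) := mul_le_mul_of_nonneg_right hmin' (by linarith)
    have h3 : μ k * (1 - x k * (3 / 4 + eb k)) ≤ μ k * (1 - x k * (3 / 4 + e)) :=
      mul_le_mul_of_nonneg_left (by nlinarith [mul_le_mul_of_nonneg_left hmin' hxk]) hμ0'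
    linarith
  · intro k hk hkm
    have hxk := hx k hk
    have hmin' := he_le k hk hkm
    set e := min (4 * (pred k : ℝ) * k / ((k : ℝ) + pred k) ^ 2 * μ (pred k)) (2 * lam (pred k) * ((pred k : ℝ) / k)) with he
    have hlamk0 := hlam0 k hk
    rw [hlam_pred k hk hkm]
    have hrec : lamp k * ((pred k : ℝ) / k) * (1 + x k / 4) + x k * (1 + eb k) ≤ lam k * (1 - x k * (3 / 4 + eb k)) := by
      by_cases hkM : k = M₀
      · have h1 := hcond k hk hkm; have heb0' := heb0 k hk hkm
        have hden : 0 < 1 - x k * (3 / 4 + eb k) := by nlinarith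
        rw [hlam_M k hkm hkM, div_mul_cancel₀ _ hden.ne']
      by_cases h1 : pred k = m₀
      · rw [hlam_1 k hkm hkM h1, hlamp_1 k h1]; exact (hstep1 k hk hkm h1).2
      by_cases h2 : pred (pred k) = m₀
      · rw [hlam_2 k hkm hkM h1]; exact (hstep2 k hk hkm h1 h2).2
      · exact absurd (hdepth k hk hkm h1 h2) hkM
    have h3 : x k * (1 + e) ≤ x k * (1 + eb k) := mul_le_mul_of_nonneg_left (by linarith) hxk
    have h4 : lam k * (1 - x k * (3 / 4 + eb k)) ≤ lam k * (1 - x k * (3 / 4 + e)) :=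
      mul_le_mul_of_nonneg_left (by nlinarith [mul_le_mul_of_nonneg_left hmin' hxk]) hlamk0
    linarith

end Summit.QuantumFields.BalabanUV.Beta.EriceRemainderEnclosureHistoryAutonomyComparisonChainFourAges

end
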